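import Literature.LinearAlgebra.Matrix.AdjoinSingletonSimpleFactors
import Literature.NumberTheory.Rogawski1990.CartanIndex
import Literature.NumberTheory.Rogawski1990.QuasiSplitRankTwoPrescribedCharpoly
import Literature.NumberTheory.Rogawski1990.EndoscopicClassesOverStableClass
import HarnessLib

/-!
# The dictionary «endoscopic classes over `𝒪_st(γ₀)` ↔ degree-one τ-stable factors of the Cartan algebra `L[γ₀]`» and the (KS-2b) bijection
# `e(γ₀) : {𝒪H ↦ 𝒪_st(γ₀)} ≃ {χ ∈ A(γ₀)^∨ ∣ χ ≠ 1}` (Rogawski 1990, §3.4–§3.6 pp. 27–33, §5.4 (5.4.5) pp. 72–74; Kottwitz 1986 §9)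

Topic `NumberTheory/Rogawski1990`; namespace `Literature.NumberTheory.Rogawski1990`; THEOREMS ONLY (no definition, no instance, no notation, no
named fact, no `sorry`).  Cell `pub/hodgecm-mathlib`, ENGINE T1 (crux H413 = `stmt-HodgeConjecture-24833`), row O11 «pre-stabilisation of a regular
class», sub-row **(KS-2b)** of RULING #99 (c): the dictionary which the count ★ `MatchingAdeleG₂.stableOrbitalSum_map_toAdelic_eq_of_sum_deg_eq_three`
(★ `PreStabilisationCountSigns`) takes as its hypotheses `(deg, hdeg, hsum, s, hs, hrange)` at `ι := cartanIndex γ₀` (★ `CartanIndex`), and the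
resulting bijection `e(γ₀)` (★ `exists_equiv_addChar_ne_one_of_sum_deg_eq_three`, `SumZeroHyperplaneCharacters`).

THE PRINT.  [Rogawski1990, §3.4–§3.6]: for `γ₀ ∈ G = U(H)(F)` regular semisimple the Cartan algebra `K = L[γ₀] ≅ L[X]∕(p_{γ₀}) ≅ ∏ᵢ Kᵢ` carries the
adjoint involution `τ`; `T = G_{γ₀} ≅ {t ∈ K : t τ(t) = 1}`; the factors `Kᵢ` with `τKᵢ = Kᵢ` index the obstruction group `A(T)` ([Prop. 3.5.2 p. 29], types
(1)(2)(3) of [§3.6 p. 31]).  [§5.4 (5.4.5) p. 74]: the classes `{γ_H}` of `H = U(2) × U(1)` mapping to `𝒪_st(γ₀)` number `3 ∕ 1 ∕ 0` — one for each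
DEGREE-ONE τ-stable factor `Kᵢ = L`, i.e. each root `u ∈ L` of `p_{γ₀}` with `u σ(u) = 1` (the `U(1)`-eigenvalue of `γ_H`), and the `κ ≠ 1` in `𝓡(T∕F)` are
the corresponding coordinate signs.

WHAT IS TYPED (generic: any fields `F ⊆ L`, `σ` an involution of `L` fixing `F`, `H` `σ`-hermitian invertible, `γ` regular semisimple `H`-unitary —
the variables of ★ `cartanInvolution` ∕ ★ `cartanIndex`; `B := L[γ] = Algebra.adjoin L {γ} ⊆ M_N(L)`, `γ′ := ⟨γ, _⟩ ∈ B`, `deg 𝔪 := dim_L (B ∕ 𝔪)`):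
* INPUT (★ `LinearAlgebra/Matrix/AdjoinSingletonSimpleFactors`, the field-free half): `dim_L B = N`, `∑_{all 𝔪} deg 𝔪 = N`, and the root factors
  `𝔪_u ∋ γ − u` of the roots `u ∈ L` of `p_γ` — existence, uniqueness, `deg 𝔪_u = 1`, and every degree-one factor is an `𝔪_u`
  (`exists_maximalSpectrum_matrixGen_sub_algebraMap_mem`, `maximalSpectrum_eq_of_matrixGen_sub_algebraMap_mem`,
  `finrank_quotient_eq_one_of_matrixGen_sub_algebraMap_mem`, `exists_matrixGen_sub_algebraMap_mem_of_finrank_eq_one`, …).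
* §1 the involution (★ `cartanInvolution`): `cartanInvolution_algebraMap` (`τ(u·1) = σ(u)·1`), `cartanInvolution_gen_mul_gen` (`τ(γ)γ = 1`),
  `cartanInvolution_gen_sub_algebraMap` (`τ(γ − u) = −τ(γ)σ(u)·(γ − u)` for `σ(u)u = 1`), **`comap_cartanInvolution_eq_of_gen_sub_algebraMap_mem`**
  (`𝔪_u` is τ-STABLE for a norm-one root) and the converse **`map_mul_self_eq_one_of_comap_cartanInvolution_eq`** (`τ𝔪_u = 𝔪_u ⇒ σ(u) u = 1`),
  **`comap_cartanInvolution_eq_of_anisotropic`** — for ANISOTROPIC `H` (`⟪v,v⟫_H = 0 ⇒ v = 0`, ★ `hermForm`) EVERY factor is τ-stable (else the idempotent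
  `e` of a factor with `τ𝔪 ≠ 𝔪` has `τ(e)e = 0`, i.e. `ᵗ(σe) H e = 0`: the image of `e ≠ 0` is totally isotropic), hence
  **`sum_finrank_quotient_cartanIndex_eq : ∑_{𝔪 ∈ cartanIndex} deg 𝔪 = N`**, and **`exists_cartanIndex_injective`** — THE DICTIONARY: an injective
  family `r : I → L` exhausting the norm-one roots of `p_γ` is re-indexed `s : I ↪ cartanIndex`, `γ − r(x) ∈ s(x)`, image = `{𝔪 ∣ deg 𝔪 = 1}`.
* §2 `U(3)` (`N = 3`, `σ` non-trivial, `L` infinite): **`exists_endoscopicIndex`** — `I := {𝒪H : StableClassH σ Φ₂ Φ₁ ∣ 𝒪H ↦ 𝒪_st(γ₀)}`, `r := sndVal`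
  (★ `TransfersTo.isRoot_sndVal`, ★ `map_sndVal_mul_sndVal_eq_one`, ★ `injOn_sndVal_setOf_transfersTo`, ★ (KS-2a) `exists_stableClassH_transfersTo_and_sndVal_eq`);
  **`exists_endoscopicIndex_of_anisotropic`** — the whole `(hdeg, hsum = 3, s, hs, hrange)` package of ★ `…_of_sum_deg_eq_three` for anisotropic `H`.
* §3 **`exists_endoscopicKappaEquiv`** — (KS-2b): `∃ s e`, `e : {𝒪H ↦ 𝒪_st(γ₀)} ≃ {χ ∈ (cartanObsSubgroup (cartanIndex γ₀))^∨ ∣ χ ≠ 1}` with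
  `e(𝒪H)(ε) = (−1)^{ε(s 𝒪H)}` (so `|𝓡| = #{𝒪H ↦ 𝒪_st(γ₀)} + 1 = 4 ∕ 2 ∕ 1`).

## References
* [Rogawski1990] J. D. Rogawski, *Automorphic Representations of Unitary Groups in Three Variables*, Ann. of Math. Stud. 123 (1990), §3.4–§3.6
  pp. 27–33 (Prop. 3.5.2 p. 29, §3.6 p. 31), §5.4 (5.4.2)–(5.4.5) pp. 72–74, §14.5 p. 237.
* [Kottwitz1986] R. E. Kottwitz, *Stable trace formula: elliptic singular terms*, Math. Ann. 275 (1986), §9.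
-/

set_option autoImplicit false

noncomputable section

open Polynomial
open scoped Matrix BigOperators

namespace Literature.NumberTheory.Rogawski1990

open Literature.LinearAlgebra.Matrix

/-! ## §1 The involution: τ-stability of the root factors (`σ(u) u = 1`), anisotropy ⇒ EVERY factor is τ-stable, `∑_{τ-stable} deg = N` -/

section Involution

open Literature.AlgebraicGeometry.ShimuraVarieties (hermForm)

variable {F L : Type} [Field F] [Field L] [Algebra F L] (σ : L →+* L) {N : ℕ} {H : Matrix (Fin N) (Fin N) L} {γ : Matrix (Fin N) (Fin N) L}
variable (hσF : ∀ q : F, σ (algebraMap F L q) = algebraMap F L q) (hσσ : ∀ x : L, σ (σ x) = x) (hHdet : IsUnit H.det) (hH : (H.map σ)ᵀ = H)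
  (hreg : γ.charpoly.Separable) (hγ : (γ.map σ)ᵀ * H * γ = H)

/-- `τ` is `σ`-SEMILINEAR on the scalars: `τ(u · 1) = σ(u) · 1` (`H⁻¹ ᵗ(σ(u·1)) H = σ(u) · 1`). [cite: Rogawski1990, §3.5 p. 29] -/
theorem cartanInvolution_algebraMap (u : L) :
    cartanInvolution σ hσF hσσ hHdet hH hreg hγ (algebraMap L ↥(Algebra.adjoin L ({γ} : Set (Matrix (Fin N) (Fin N) L))) u) =
      algebraMap L ↥(Algebra.adjoin L ({γ} : Set (Matrix (Fin N) (Fin N) L))) (σ u) := by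
  apply Subtype.ext
  rw [coe_cartanInvolution, coe_algebraMap_adjoin_singleton_eq_scalar, coe_algebraMap_adjoin_singleton_eq_scalar, Matrix.scalar_apply, Matrix.scalar_apply, Matrix.diagonal_map (map_zero σ),
    Matrix.diagonal_transpose, ← Matrix.smul_one_eq_diagonal, Matrix.mul_smul, Matrix.mul_one, Matrix.smul_mul, Matrix.nonsing_inv_mul H hHdet]

/-- `τ(γ) · γ = 1` in `L[γ]` (★ `coe_cartanInvolution_self_mul_self`). [cite: Rogawski1990, §3.4 p. 27] -/
theorem cartanInvolution_gen_mul_gen :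
    cartanInvolution σ hσF hσσ hHdet hH hreg hγ ⟨γ, Algebra.self_mem_adjoin_singleton L γ⟩ *
      (⟨γ, Algebra.self_mem_adjoin_singleton L γ⟩ : ↥(Algebra.adjoin L ({γ} : Set (Matrix (Fin N) (Fin N) L)))) = 1 :=
  Subtype.ext (coe_cartanInvolution_self_mul_self σ hσF hσσ hHdet hH hreg hγ)

/-- **`τ(γ − u) = −τ(γ) σ(u) · (γ − u)` when `σ(u) u = 1`**: the root ideal of a NORM-ONE root is τ-stable. [cite: Rogawski1990, §3.6 p. 31] -/
theorem cartanInvolution_gen_sub_algebraMap {u : L} (hu1 : σ u * u = 1) :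
    cartanInvolution σ hσF hσσ hHdet hH hreg hγ ((⟨γ, Algebra.self_mem_adjoin_singleton L γ⟩ : ↥(Algebra.adjoin L ({γ} : Set (Matrix (Fin N) (Fin N) L)))) -
        algebraMap L ↥(Algebra.adjoin L ({γ} : Set (Matrix (Fin N) (Fin N) L))) u) =
      -(cartanInvolution σ hσF hσσ hHdet hH hreg hγ ⟨γ, Algebra.self_mem_adjoin_singleton L γ⟩ *
          algebraMap L ↥(Algebra.adjoin L ({γ} : Set (Matrix (Fin N) (Fin N) L))) (σ u)) *
        ((⟨γ, Algebra.self_mem_adjoin_singleton L γ⟩ : ↥(Algebra.adjoin L ({γ} : Set (Matrix (Fin N) (Fin N) L)))) -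
          algebraMap L ↥(Algebra.adjoin L ({γ} : Set (Matrix (Fin N) (Fin N) L))) u) := by
  have h1 := cartanInvolution_gen_mul_gen σ hσF hσσ hHdet hH hreg hγ
  have h2 : algebraMap L ↥(Algebra.adjoin L ({γ} : Set (Matrix (Fin N) (Fin N) L))) (σ u) *
      algebraMap L ↥(Algebra.adjoin L ({γ} : Set (Matrix (Fin N) (Fin N) L))) u = 1 := by rw [← map_mul, hu1, map_one]
  rw [map_sub, cartanInvolution_algebraMap]
  linear_combination (algebraMap L ↥(Algebra.adjoin L ({γ} : Set (Matrix (Fin N) (Fin N) L))) (σ u)) * h1 -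
    (cartanInvolution σ hσF hσσ hHdet hH hreg hγ ⟨γ, Algebra.self_mem_adjoin_singleton L γ⟩) * h2

/-- `γ − u ∈ 𝔪`, `σ(u) u = 1` ⇒ `γ − u ∈ τ⁻¹𝔪`. [cite: Rogawski1990, §3.6 p. 31] -/
theorem gen_sub_algebraMap_mem_comap_cartanInvolution (𝔪 : Ideal ↥(Algebra.adjoin L ({γ} : Set (Matrix (Fin N) (Fin N) L)))) {u : L}
    (h : (⟨γ, Algebra.self_mem_adjoin_singleton L γ⟩ : ↥(Algebra.adjoin L ({γ} : Set (Matrix (Fin N) (Fin N) L)))) -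
      algebraMap L ↥(Algebra.adjoin L ({γ} : Set (Matrix (Fin N) (Fin N) L))) u ∈ 𝔪) (hu1 : σ u * u = 1) :
    (⟨γ, Algebra.self_mem_adjoin_singleton L γ⟩ : ↥(Algebra.adjoin L ({γ} : Set (Matrix (Fin N) (Fin N) L)))) -
      algebraMap L ↥(Algebra.adjoin L ({γ} : Set (Matrix (Fin N) (Fin N) L))) u ∈ 𝔪.comap (cartanInvolution σ hσF hσσ hHdet hH hreg hγ) := by
  rw [Ideal.mem_comap, cartanInvolution_gen_sub_algebraMap σ hσF hσσ hHdet hH hreg hγ hu1]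
  exact 𝔪.mul_mem_left _ h

/-- **The root factor of a norm-one root is τ-STABLE**: `τ⁻¹𝔪_u = 𝔪_u` for `p_γ(u) = 0`, `σ(u) u = 1`. [cite: Rogawski1990, §3.6 p. 31; §5.4 p. 74] -/
theorem comap_cartanInvolution_eq_of_gen_sub_algebraMap_mem (𝔪 : MaximalSpectrum ↥(Algebra.adjoin L ({γ} : Set (Matrix (Fin N) (Fin N) L)))) {u : L}
    (h : (⟨γ, Algebra.self_mem_adjoin_singleton L γ⟩ : ↥(Algebra.adjoin L ({γ} : Set (Matrix (Fin N) (Fin N) L)))) -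
      algebraMap L ↥(Algebra.adjoin L ({γ} : Set (Matrix (Fin N) (Fin N) L))) u ∈ 𝔪.asIdeal) (hu1 : σ u * u = 1) :
    𝔪.asIdeal.comap (cartanInvolution σ hσF hσσ hHdet hH hreg hγ) = 𝔪.asIdeal := by
  haveI := 𝔪.isMaximal
  have key := maximalSpectrum_eq_of_matrixGen_sub_algebraMap_mem γ (𝔪 := ⟨𝔪.asIdeal.comap (cartanInvolution σ hσF hσσ hHdet hH hreg hγ), inferInstance⟩)
    (𝔫 := 𝔪) (gen_sub_algebraMap_mem_comap_cartanInvolution σ hσF hσσ hHdet hH hreg hγ 𝔪.asIdeal h hu1) h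
  exact congrArg MaximalSpectrum.asIdeal key

/-- **Conversely, a τ-stable root factor has a NORM-ONE root**: `τ⁻¹𝔪 = 𝔪 ∋ γ − u` ⇒ `σ(u) u = 1` (`τ(γ) γ = 1` and `τ(γ − u) = τ(γ) − σ(u) ∈ 𝔪`).
[cite: Rogawski1990, §3.6 p. 31; §5.4 p. 74] -/
theorem map_mul_self_eq_one_of_comap_cartanInvolution_eq (𝔪 : MaximalSpectrum ↥(Algebra.adjoin L ({γ} : Set (Matrix (Fin N) (Fin N) L))))
    (hst : 𝔪.asIdeal.comap (cartanInvolution σ hσF hσσ hHdet hH hreg hγ) = 𝔪.asIdeal) {u : L}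
    (h : (⟨γ, Algebra.self_mem_adjoin_singleton L γ⟩ : ↥(Algebra.adjoin L ({γ} : Set (Matrix (Fin N) (Fin N) L)))) -
      algebraMap L ↥(Algebra.adjoin L ({γ} : Set (Matrix (Fin N) (Fin N) L))) u ∈ 𝔪.asIdeal) : σ u * u = 1 := by
  have hgen := cartanInvolution_gen_mul_gen σ hσF hσσ hHdet hH hreg hγ
  have hτ : cartanInvolution σ hσF hσσ hHdet hH hreg hγ ⟨γ, Algebra.self_mem_adjoin_singleton L γ⟩ -
      algebraMap L ↥(Algebra.adjoin L ({γ} : Set (Matrix (Fin N) (Fin N) L))) (σ u) ∈ 𝔪.asIdeal := by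
    have h' := h
    rw [← hst, Ideal.mem_comap, map_sub, cartanInvolution_algebraMap] at h'
    exact h'
  have hmem : algebraMap L ↥(Algebra.adjoin L ({γ} : Set (Matrix (Fin N) (Fin N) L))) (1 - σ u * u) ∈ 𝔪.asIdeal := by
    have hsum := 𝔪.asIdeal.add_mem (𝔪.asIdeal.mul_mem_right (⟨γ, Algebra.self_mem_adjoin_singleton L γ⟩ : ↥(Algebra.adjoin L ({γ} : Set (Matrix (Fin N) (Fin N) L)))) hτ)
      (𝔪.asIdeal.mul_mem_left (algebraMap L ↥(Algebra.adjoin L ({γ} : Set (Matrix (Fin N) (Fin N) L))) (σ u)) h)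
    convert hsum using 1
    rw [map_sub, map_one, map_mul]
    linear_combination (-1 : ↥(Algebra.adjoin L ({γ} : Set (Matrix (Fin N) (Fin N) L)))) * hgen
  rw [algebraMap_mem_maximalSpectrum_adjoin_iff, sub_eq_zero] at hmem
  exact hmem.symm

/-- **ANISOTROPY ⇒ EVERY SIMPLE FACTOR OF `L[γ]` IS τ-STABLE** (all tori of an anisotropic `U(H)` are «elliptic»): were `τ𝔪 ≠ 𝔪`, the idempotent
`e` of the factor `𝔪` (`e ≡ 1 (𝔪)`, `e ≡ 0` at the other factors — Mathlib `IsArtinianRing.equivPi`, `L[γ]` reduced ★ `isReduced_adjoin_singleton`) would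
satisfy `τ(e) e = 0`, i.e. `ᵗ(σe) H e = 0`: the hermitian form vanishes on the image of `e ≠ 0` — an isotropic vector. [cite: Rogawski1990, §3.4 p. 27; §14.5 p. 237] -/
theorem comap_cartanInvolution_eq_of_anisotropic (hanis : ∀ v : Fin N → L, hermForm σ H v v = 0 → v = 0)
    (𝔪 : MaximalSpectrum ↥(Algebra.adjoin L ({γ} : Set (Matrix (Fin N) (Fin N) L)))) :
    𝔪.asIdeal.comap (cartanInvolution σ hσF hσσ hHdet hH hreg hγ) = 𝔪.asIdeal := by
  classical
  haveI := 𝔪.isMaximal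
  by_contra hne
  haveI : IsArtinianRing ↥(Algebra.adjoin L ({γ} : Set (Matrix (Fin N) (Fin N) L))) := IsArtinianRing.of_finite L _
  haveI : IsReduced ↥(Algebra.adjoin L ({γ} : Set (Matrix (Fin N) (Fin N) L))) := isReduced_adjoin_singleton γ hreg
  let 𝔪' : MaximalSpectrum ↥(Algebra.adjoin L ({γ} : Set (Matrix (Fin N) (Fin N) L))) :=
    ⟨𝔪.asIdeal.comap (cartanInvolution σ hσF hσσ hHdet hH hreg hγ), inferInstance⟩
  have hne' : 𝔪' ≠ 𝔪 := fun h => hne (congrArg MaximalSpectrum.asIdeal h)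
  -- the idempotent of the factor `𝔪`
  set E := IsArtinianRing.equivPi ↥(Algebra.adjoin L ({γ} : Set (Matrix (Fin N) (Fin N) L))) with hE
  set e : ↥(Algebra.adjoin L ({γ} : Set (Matrix (Fin N) (Fin N) L))) := E.symm (Pi.single 𝔪 1) with he
  have hEe : ∀ 𝔫 : MaximalSpectrum ↥(Algebra.adjoin L ({γ} : Set (Matrix (Fin N) (Fin N) L))),
      Ideal.Quotient.mk 𝔫.asIdeal e = (Pi.single 𝔪 1 : ∀ 𝔫 : MaximalSpectrum ↥(Algebra.adjoin L ({γ} : Set (Matrix (Fin N) (Fin N) L))),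
        ↥(Algebra.adjoin L ({γ} : Set (Matrix (Fin N) (Fin N) L))) ⧸ 𝔫.asIdeal) 𝔫 := fun 𝔫 => by
    have h := congrFun (E.apply_symm_apply (Pi.single 𝔪 1)) 𝔫
    rw [← he, IsArtinianRing.equivPi_apply] at h
    exact h
  have he_mem : ∀ 𝔫 : MaximalSpectrum ↥(Algebra.adjoin L ({γ} : Set (Matrix (Fin N) (Fin N) L))), 𝔫 ≠ 𝔪 → e ∈ 𝔫.asIdeal := fun 𝔫 h𝔫 => by
    rw [← Ideal.Quotient.eq_zero_iff_mem, hEe, Pi.single_eq_of_ne h𝔫]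
  have he_not : e ∉ 𝔪.asIdeal := fun h => by
    have h1 := hEe 𝔪
    rw [Pi.single_eq_same, Ideal.Quotient.eq_zero_iff_mem.2 h] at h1
    exact 𝔪.isMaximal.ne_top ((Ideal.eq_top_iff_one _).2 (Ideal.Quotient.eq_zero_iff_mem.1 h1.symm))
  -- `τ(e) e` lies in every maximal ideal, hence vanishes
  have hτe : cartanInvolution σ hσF hσσ hHdet hH hreg hγ e ∈ 𝔪.asIdeal := Ideal.mem_comap.1 (he_mem 𝔪' hne')
  have hprod : cartanInvolution σ hσF hσσ hHdet hH hreg hγ e * e = 0 := by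
    apply E.injective
    rw [map_zero]
    funext 𝔫
    rw [IsArtinianRing.equivPi_apply, Pi.zero_apply]
    change Ideal.Quotient.mk 𝔫.asIdeal (cartanInvolution σ hσF hσσ hHdet hH hreg hγ e * e) = 0
    rw [Ideal.Quotient.eq_zero_iff_mem]
    by_cases h𝔫 : 𝔫 = 𝔪
    · rw [h𝔫]; exact 𝔪.asIdeal.mul_mem_right _ hτe
    · exact 𝔫.asIdeal.mul_mem_left _ (he_mem 𝔫 h𝔫)
  -- as matrices: `ᵗ(σe) H e = 0`, so the hermitian form vanishes on the image of `e`
  have hmat : (((e : ↥(Algebra.adjoin L ({γ} : Set (Matrix (Fin N) (Fin N) L)))) : Matrix (Fin N) (Fin N) L).map σ)ᵀ * H *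
      (e : Matrix (Fin N) (Fin N) L) = 0 := by
    have h := congrArg (fun b : ↥(Algebra.adjoin L ({γ} : Set (Matrix (Fin N) (Fin N) L))) => H * (b : Matrix (Fin N) (Fin N) L)) hprod
    simp only [Subalgebra.coe_mul, coe_cartanInvolution, ZeroMemClass.coe_zero, Matrix.mul_zero] at h
    rwa [Matrix.mul_assoc, Matrix.mul_assoc, Matrix.mul_nonsing_inv_cancel_left _ _ hHdet, ← Matrix.mul_assoc] at h
  have hiso : ∀ v : Fin N → L, hermForm σ H ((e : Matrix (Fin N) (Fin N) L) *ᵥ v) ((e : Matrix (Fin N) (Fin N) L) *ᵥ v) = 0 := fun v => by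
    have hσv : σ ∘ ((e : Matrix (Fin N) (Fin N) L) *ᵥ v) = ((e : Matrix (Fin N) (Fin N) L).map σ) *ᵥ (σ ∘ v) :=
      funext fun i => RingHom.map_mulVec σ _ v i
    unfold hermForm
    rw [hσv, ← Matrix.vecMul_transpose, ← Matrix.dotProduct_mulVec, Matrix.mulVec_mulVec, Matrix.mulVec_mulVec, hmat, Matrix.zero_mulVec,
      dotProduct_zero]
  have he0 : (e : Matrix (Fin N) (Fin N) L) = 0 := by
    ext i j
    have h := congrFun (hanis _ (hiso (Pi.single j 1))) i
    rwa [Matrix.mulVec_single_one] at h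
  exact he_not (by rw [show e = 0 from Subtype.ext he0]; exact 𝔪.asIdeal.zero_mem)

/-- **`∑_{𝔪 τ-stable} dim_L (L[γ] ∕ 𝔪) = N` for anisotropic `H`** (every factor is τ-stable; ★ `sum_finrank_adjoin_singleton_quotient_eq`): `r′`-bookkeeping of
[§3.6] — for `N = 3` the degree patterns `1+1+1 ∕ 1+2 ∕ 3` of the Cartan types (1) ∕ (2) ∕ (3). [cite: Rogawski1990, §3.6 p. 31; §5.4 p. 74] -/
theorem sum_finrank_quotient_cartanIndex_eq [Fintype (MaximalSpectrum ↥(Algebra.adjoin L ({γ} : Set (Matrix (Fin N) (Fin N) L))))]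
    [Fintype (cartanIndex σ hσF hσσ hHdet hH hreg hγ)] (hanis : ∀ v : Fin N → L, hermForm σ H v v = 0 → v = 0) :
    ∑ 𝔪 : cartanIndex σ hσF hσσ hHdet hH hreg hγ, Module.finrank L (↥(Algebra.adjoin L ({γ} : Set (Matrix (Fin N) (Fin N) L))) ⧸ 𝔪.1.asIdeal) = N := by
  exact (Fintype.sum_equiv (Equiv.subtypeUnivEquiv (comap_cartanInvolution_eq_of_anisotropic σ hσF hσσ hHdet hH hreg hγ hanis))
    (fun 𝔪 : cartanIndex σ hσF hσσ hHdet hH hreg hγ => Module.finrank L (↥(Algebra.adjoin L ({γ} : Set (Matrix (Fin N) (Fin N) L))) ⧸ 𝔪.1.asIdeal))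
    (fun 𝔪 => Module.finrank L (↥(Algebra.adjoin L ({γ} : Set (Matrix (Fin N) (Fin N) L))) ⧸ 𝔪.asIdeal)) (fun _ => rfl)).trans
    (sum_finrank_adjoin_singleton_quotient_eq γ hreg)

/-- **THE DICTIONARY.**  Any family `r : I → L` of NORM-ONE ROOTS of `p_γ` (`p_γ(r x) = 0`, `σ(r x) · r x = 1`) that is injective and exhausts the
norm-one roots is re-indexed by the τ-stable simple factors: `s : I ↪ cartanIndex` with `γ − r(x) ∈ s(x)` (this PINS `s(x)`: `maximalSpectrum_eq_of_matrixGen_sub_algebraMap_mem`)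
and IMAGE = the factors of degree one.  For `I` = the endoscopic classes over `𝒪_st(γ)` and `r = sndVal` this is the bijection
«`{𝒪H ↦ 𝒪_st(γ)} ↔ {degree-1 τ-stable factors}`» behind (5.4.5). [cite: Rogawski1990, §5.4 (5.4.5) p. 74; §3.6 p. 31] -/
theorem exists_cartanIndex_injective {I : Type*} (r : I → L) (hroot : ∀ x, γ.charpoly.IsRoot (r x)) (hone : ∀ x, σ (r x) * r x = 1)
    (hinj : Function.Injective r) (hsurj : ∀ u : L, γ.charpoly.IsRoot u → σ u * u = 1 → ∃ x, r x = u) :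
    ∃ s : I → cartanIndex σ hσF hσσ hHdet hH hreg hγ, Function.Injective s ∧
      (∀ 𝔪 : cartanIndex σ hσF hσσ hHdet hH hreg hγ,
        (∃ x, s x = 𝔪) ↔ Module.finrank L (↥(Algebra.adjoin L ({γ} : Set (Matrix (Fin N) (Fin N) L))) ⧸ 𝔪.1.asIdeal) = 1) ∧
      ∀ x, (⟨γ, Algebra.self_mem_adjoin_singleton L γ⟩ : ↥(Algebra.adjoin L ({γ} : Set (Matrix (Fin N) (Fin N) L)))) -
        algebraMap L ↥(Algebra.adjoin L ({γ} : Set (Matrix (Fin N) (Fin N) L))) (r x) ∈ (s x).1.asIdeal := by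
  choose 𝔪 h𝔪 using fun x => exists_maximalSpectrum_matrixGen_sub_algebraMap_mem γ (hroot x)
  refine ⟨fun x => ⟨𝔪 x, comap_cartanInvolution_eq_of_gen_sub_algebraMap_mem σ hσF hσσ hHdet hH hreg hγ (𝔪 x) (h𝔪 x) (hone x)⟩, ?_, ?_, fun x => h𝔪 x⟩
  · intro x y hxy
    have h' : 𝔪 x = 𝔪 y := congrArg Subtype.val hxy
    exact hinj (eq_of_matrixGen_sub_algebraMap_mem γ (𝔪 y) (h' ▸ h𝔪 x) (h𝔪 y))
  · intro 𝔫
    constructor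
    · rintro ⟨x, rfl⟩
      exact finrank_quotient_eq_one_of_matrixGen_sub_algebraMap_mem γ _ (h𝔪 x)
    · intro h1
      obtain ⟨u, hu⟩ := exists_matrixGen_sub_algebraMap_mem_of_finrank_eq_one γ 𝔫.1 h1
      obtain ⟨x, hx⟩ := hsurj u (isRoot_charpoly_of_matrixGen_sub_algebraMap_mem γ 𝔫.1 hu)
        (map_mul_self_eq_one_of_comap_cartanInvolution_eq σ hσF hσσ hHdet hH hreg hγ 𝔫.1 𝔫.2 hu)
      refine ⟨x, Subtype.ext (maximalSpectrum_eq_of_matrixGen_sub_algebraMap_mem γ (h𝔪 x) ?_)⟩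
      rw [hx]; exact hu

end Involution

/-! ## §2 `U(3)`: the endoscopic classes over `𝒪_st(γ₀)` indexed by the degree-one τ-stable factors of `L[γ₀]` -/

section Unitary

open Literature.AlgebraicGeometry.ShimuraVarieties (unitaryGroup hermForm)

variable {F L : Type} [Field F] [Field L] [Algebra F L] [Infinite L] (σ : L →+* L) {H : Matrix (Fin 3) (Fin 3) L}
variable (hσF : ∀ q : F, σ (algebraMap F L q) = algebraMap F L q) (hσσ : ∀ x : L, σ (σ x) = x) (hHdet : IsUnit H.det) (hH : (H.map σ)ᵀ = H)

/-- **(5.4.5) as a dictionary — `{𝒪H ↦ 𝒪_st(γ₀)} ↪ cartanIndex γ₀`, image = degree-one factors, `γ₀ − sndVal 𝒪H ∈ s(𝒪H)`.**  For `γ₀ ∈ U(H)(F)` regular,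
`σ` a non-trivial involution, `H` hermitian invertible: the stable classes `𝒪H` of `H = U(Φ₂) × U(Φ₁)` transferring to `𝒪_st(γ₀)` (★ `StableClassH.TransfersTo`)
correspond, via `𝒪H ↦ sndVal 𝒪H ↦ 𝔪_{sndVal 𝒪H}`, to the τ-stable factors `𝔪` of `L[γ₀]` with `dim_L (L[γ₀] ∕ 𝔪) = 1` — ★ `injOn_sndVal_setOf_transfersTo`,
★ `TransfersTo.isRoot_sndVal`, ★ `map_sndVal_mul_sndVal_eq_one`, ★ (KS-2a) `exists_stableClassH_transfersTo_and_sndVal_eq`, and §1.  This is the `(s, hs, hrange)`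
input of ★ `MatchingAdeleG₂.stableOrbitalSum_map_toAdelic_eq_of_sum_deg_eq_three` at `ι := cartanIndex γ₀`, `deg 𝔪 := dim_L (L[γ₀] ∕ 𝔪)`.
[cite: Rogawski1990, §5.4 (5.4.5) pp. 72–74; §3.6 p. 31] -/
theorem exists_endoscopicIndex (hσ : ∃ z, σ z ≠ z) (γ₀ : unitaryGroup σ H) (hreg : IsRegularElt (γ₀ : GL (Fin 3) L)) :
    ∃ s : {𝒪H : StableClassH σ (Matrix.of fun i j : Fin 2 => if i.val + j.val + 1 = 2 then (1 : L) else 0)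
        (Matrix.of fun i j : Fin 1 => if i.val + j.val + 1 = 1 then (1 : L) else 0) // 𝒪H.TransfersTo H endoForm_antidiagOne (stableClassOf σ H γ₀)} →
        cartanIndex σ hσF hσσ hHdet hH hreg γ₀.2,
      Function.Injective s ∧
      (∀ 𝔪 : cartanIndex σ hσF hσσ hHdet hH hreg γ₀.2, (∃ x, s x = 𝔪) ↔
        Module.finrank L (↥(Algebra.adjoin L ({((γ₀ : GL (Fin 3) L) : Matrix (Fin 3) (Fin 3) L)} : Set (Matrix (Fin 3) (Fin 3) L))) ⧸ 𝔪.1.asIdeal) = 1) ∧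
      ∀ x, (⟨((γ₀ : GL (Fin 3) L) : Matrix (Fin 3) (Fin 3) L), Algebra.self_mem_adjoin_singleton L _⟩ :
          ↥(Algebra.adjoin L ({((γ₀ : GL (Fin 3) L) : Matrix (Fin 3) (Fin 3) L)} : Set (Matrix (Fin 3) (Fin 3) L)))) -
        algebraMap L _ x.1.sndVal ∈ (s x).1.asIdeal := by
  have hJ : IsUnit ((Matrix.of fun i j : Fin 1 => if i.val + j.val + 1 = 1 then (1 : L) else 0) 0 0) := by
    simp only [Matrix.of_apply, Fin.val_zero, zero_add, ↓reduceIte, isUnit_one]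
  refine exists_cartanIndex_injective σ hσF hσσ hHdet hH hreg γ₀.2 (fun x => x.1.sndVal) (fun x => ?_) (fun x => StableClassH.map_sndVal_mul_sndVal_eq_one hJ x.1)
    (fun x y hxy => Subtype.ext (StableClassH.injOn_sndVal_setOf_transfersTo endoForm_antidiagOne (stableClassOf σ H γ₀) x.2 y.2 hxy)) (fun u hu hu1 => ?_)
  · have h := StableClassH.TransfersTo.isRoot_sndVal x.2
    rwa [StableClass.charpoly_stableClassOf] at h
  · obtain ⟨𝒪H, h𝒪H, hval⟩ := exists_stableClassH_transfersTo_and_sndVal_eq σ hσσ hσ hHdet.ne_zero γ₀ hreg hu (by rw [mul_comm]; exact hu1)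
    exact ⟨⟨𝒪H, h𝒪H⟩, hval⟩

/-- **The `(deg, s)`-package of the pre-stabilisation count for an ANISOTROPIC `H`** — exactly the hypotheses `hdeg`, `hsum`, `hs`, `hrange` of ★
`MatchingAdeleG₂.stableOrbitalSum_map_toAdelic_eq_of_sum_deg_eq_three` (★ `PreStabilisationCountSigns`) at `ι := cartanIndex γ₀`,
`deg 𝔪 := dim_L (L[γ₀] ∕ 𝔪)`, `I := {𝒪H ↦ 𝒪_st(γ₀)}`: `1 ≤ deg`, `∑ deg = 3`, `s` injective with image the degree-one factors (and the pin
`γ₀ − sndVal 𝒪H ∈ s 𝒪H`). [cite: Rogawski1990, §5.4 (5.4.2)–(5.4.5) pp. 72–74; §3.6 p. 31] -/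
theorem exists_endoscopicIndex_of_anisotropic (hσ : ∃ z, σ z ≠ z) (γ₀ : unitaryGroup σ H) (hreg : IsRegularElt (γ₀ : GL (Fin 3) L))
    (hanis : ∀ v : Fin 3 → L, hermForm σ H v v = 0 → v = 0) [Fintype (cartanIndex σ hσF hσσ hHdet hH hreg γ₀.2)] :
    (∀ 𝔪 : cartanIndex σ hσF hσσ hHdet hH hreg γ₀.2,
        1 ≤ Module.finrank L (↥(Algebra.adjoin L ({((γ₀ : GL (Fin 3) L) : Matrix (Fin 3) (Fin 3) L)} : Set (Matrix (Fin 3) (Fin 3) L))) ⧸ 𝔪.1.asIdeal)) ∧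
    ∑ 𝔪 : cartanIndex σ hσF hσσ hHdet hH hreg γ₀.2,
        Module.finrank L (↥(Algebra.adjoin L ({((γ₀ : GL (Fin 3) L) : Matrix (Fin 3) (Fin 3) L)} : Set (Matrix (Fin 3) (Fin 3) L))) ⧸ 𝔪.1.asIdeal) = 3 ∧
    ∃ s : {𝒪H : StableClassH σ (Matrix.of fun i j : Fin 2 => if i.val + j.val + 1 = 2 then (1 : L) else 0)
        (Matrix.of fun i j : Fin 1 => if i.val + j.val + 1 = 1 then (1 : L) else 0) // 𝒪H.TransfersTo H endoForm_antidiagOne (stableClassOf σ H γ₀)} →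
        cartanIndex σ hσF hσσ hHdet hH hreg γ₀.2,
      Function.Injective s ∧
      (∀ 𝔪 : cartanIndex σ hσF hσσ hHdet hH hreg γ₀.2, (∃ x, s x = 𝔪) ↔
        Module.finrank L (↥(Algebra.adjoin L ({((γ₀ : GL (Fin 3) L) : Matrix (Fin 3) (Fin 3) L)} : Set (Matrix (Fin 3) (Fin 3) L))) ⧸ 𝔪.1.asIdeal) = 1) ∧
      ∀ x, (⟨((γ₀ : GL (Fin 3) L) : Matrix (Fin 3) (Fin 3) L), Algebra.self_mem_adjoin_singleton L _⟩ :
          ↥(Algebra.adjoin L ({((γ₀ : GL (Fin 3) L) : Matrix (Fin 3) (Fin 3) L)} : Set (Matrix (Fin 3) (Fin 3) L)))) -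
        algebraMap L _ x.1.sndVal ∈ (s x).1.asIdeal := by
  classical
  haveI : IsArtinianRing ↥(Algebra.adjoin L ({((γ₀ : GL (Fin 3) L) : Matrix (Fin 3) (Fin 3) L)} : Set (Matrix (Fin 3) (Fin 3) L))) :=
    IsArtinianRing.of_finite L _
  haveI : Fintype (MaximalSpectrum ↥(Algebra.adjoin L ({((γ₀ : GL (Fin 3) L) : Matrix (Fin 3) (Fin 3) L)} : Set (Matrix (Fin 3) (Fin 3) L)))) :=
    Fintype.ofFinite _
  exact ⟨fun 𝔪 => one_le_finrank_adjoin_singleton_quotient _ 𝔪.1, sum_finrank_quotient_cartanIndex_eq σ hσF hσσ hHdet hH hreg γ₀.2 hanis,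
    exists_endoscopicIndex σ hσF hσσ hHdet hH hσ γ₀ hreg⟩

end Unitary

/-! ## §3 (KS-2b) THE BIJECTION `e(γ₀) : {𝒪H ↦ 𝒪_st(γ₀)} ≃ {χ ∈ A(γ₀)^∨ ∣ χ ≠ 1}` with its values pinned -/

section KappaBijection

open Literature.AlgebraicGeometry.ShimuraVarieties (unitaryGroup hermForm)

variable {F L : Type} [Field F] [Field L] [Algebra F L] [Infinite L] (σ : L →+* L) {H : Matrix (Fin 3) (Fin 3) L}
variable (hσF : ∀ q : F, σ (algebraMap F L q) = algebraMap F L q) (hσσ : ∀ x : L, σ (σ x) = x) (hHdet : IsUnit H.det) (hH : (H.map σ)ᵀ = H)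

/-- **(KS-2b) — RULING #99 (c)'s object.**  For an ANISOTROPIC hermitian `H`, `σ` a non-trivial involution and `γ₀ ∈ U(H)(F)` regular, with
`A(γ₀) := {ε : cartanIndex γ₀ → ℤ∕2 ∣ ∑ ε = 0}` (★ `cartanObsSubgroup`) and `𝓡 := ⊤ = A(γ₀)^∨`: there are the dictionary `s : {𝒪H ↦ 𝒪_st(γ₀)} ↪ cartanIndex γ₀`
(`γ₀ − sndVal 𝒪H ∈ s 𝒪H`) and a BIJECTION `e(γ₀) : {𝒪H ↦ 𝒪_st(γ₀)} ≃ {χ ≠ 1}` with `e(𝒪H)(ε) = (−1)^{ε(s 𝒪H)}` — §2 ∘ ★ `exists_equiv_addChar_ne_one_of_sum_deg_eq_three`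
(`deg 𝔪 := dim_L (L[γ₀] ∕ 𝔪)`, `∑ deg = 3` by anisotropy).  In particular `|𝓡| = #{𝒪H ↦ 𝒪_st(γ₀)} + 1 = 4 ∕ 2 ∕ 1` for the Cartan types (1) ∕ (2) ∕ (3).
[cite: Rogawski1990, §5.4 (5.4.5) pp. 72–74; §3.6 p. 31] [cite: Kottwitz1986, §9] -/
theorem exists_endoscopicKappaEquiv (hσ : ∃ z, σ z ≠ z) (γ₀ : unitaryGroup σ H) (hreg : IsRegularElt (γ₀ : GL (Fin 3) L))
    (hanis : ∀ v : Fin 3 → L, hermForm σ H v v = 0 → v = 0) [Fintype (cartanIndex σ hσF hσσ hHdet hH hreg γ₀.2)]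
    [Fintype {𝒪H : StableClassH σ (Matrix.of fun i j : Fin 2 => if i.val + j.val + 1 = 2 then (1 : L) else 0)
        (Matrix.of fun i j : Fin 1 => if i.val + j.val + 1 = 1 then (1 : L) else 0) // 𝒪H.TransfersTo H endoForm_antidiagOne (stableClassOf σ H γ₀)}]
    [Fintype (⊤ : Subgroup (AddChar ↥(cartanObsSubgroup (cartanIndex σ hσF hσσ hHdet hH hreg γ₀.2)) ℂ))] :
    ∃ (s : {𝒪H : StableClassH σ (Matrix.of fun i j : Fin 2 => if i.val + j.val + 1 = 2 then (1 : L) else 0)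
        (Matrix.of fun i j : Fin 1 => if i.val + j.val + 1 = 1 then (1 : L) else 0) // 𝒪H.TransfersTo H endoForm_antidiagOne (stableClassOf σ H γ₀)} →
        cartanIndex σ hσF hσσ hHdet hH hreg γ₀.2)
      (e : {𝒪H : StableClassH σ (Matrix.of fun i j : Fin 2 => if i.val + j.val + 1 = 2 then (1 : L) else 0)
        (Matrix.of fun i j : Fin 1 => if i.val + j.val + 1 = 1 then (1 : L) else 0) // 𝒪H.TransfersTo H endoForm_antidiagOne (stableClassOf σ H γ₀)} ≃
        {χ : (⊤ : Subgroup (AddChar ↥(cartanObsSubgroup (cartanIndex σ hσF hσσ hHdet hH hreg γ₀.2)) ℂ)) // χ ≠ 1}),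
      Function.Injective s ∧
      (∀ x, (⟨((γ₀ : GL (Fin 3) L) : Matrix (Fin 3) (Fin 3) L), Algebra.self_mem_adjoin_singleton L _⟩ :
          ↥(Algebra.adjoin L ({((γ₀ : GL (Fin 3) L) : Matrix (Fin 3) (Fin 3) L)} : Set (Matrix (Fin 3) (Fin 3) L)))) -
        algebraMap L _ x.1.sndVal ∈ (s x).1.asIdeal) ∧
      ∀ x (ε : ↥(cartanObsSubgroup (cartanIndex σ hσF hσσ hHdet hH hreg γ₀.2))),
        (((e x : (⊤ : Subgroup (AddChar ↥(cartanObsSubgroup (cartanIndex σ hσF hσσ hHdet hH hreg γ₀.2)) ℂ))) :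
            AddChar ↥(cartanObsSubgroup (cartanIndex σ hσF hσσ hHdet hH hreg γ₀.2)) ℂ)) ε =
          (-1 : ℂ) ^ ((ε : cartanIndex σ hσF hσσ hHdet hH hreg γ₀.2 → ZMod 2) (s x)).val := by
  classical
  have h1 := exists_endoscopicIndex_of_anisotropic σ hσF hσσ hHdet hH hσ γ₀ hreg hanis
  obtain ⟨hdeg, hsum, s, hs, hrange, hpin⟩ := h1
  have h2 := exists_equiv_addChar_ne_one_of_sum_deg_eq_three (cartanObsSubgroup (cartanIndex σ hσF hσσ hHdet hH hreg γ₀.2))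
    mem_cartanObsSubgroup_iff _ hdeg hsum s hs hrange
  obtain ⟨e, he⟩ := h2
  exact ⟨s, e, hs, hpin, he⟩

end KappaBijection

end Literature.NumberTheory.Rogawski1990

end
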